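import Literature.AlgebraicGeometry.Resolution.RootAdjunctionRegular
import HarnessLib

/-!
# Crux `Steer` (stmt-ResolutionOfSingularities-16345), chain W4.1: QUOTIENT AND SHIFT GLUE for `p`-radicand germs
# `S[U]/(U^p − a)` (λ1 / M helper, Theses-free, definition-free; part 1 of 2 of the ORDER of res-L0-w41-plan-1,
# HOME/STATUS 2026-08-27T05:02:14Z — split from `FrobeniusClosingSteerRadicandSingularCriterion.lean` by the 400-line rule)

OURS (campaign `res-hironaka`, rung L ★L-G4, slot W4.1; replaces the role of no printed item; NOT a statement of the
manuscript under review [claim: Hironaka2017, status: under-review]; AI review is weaker than expert review). Seat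
res-type-082.

Elementary facts about `B := S[U]/(U^p − a) = AdjoinRoot (X ^ p - C a)` (the `RadicandRing` of the W4.1 sketches) used by
the singularity criterion of part 2:
* `root_pow_eq_of` — `u^p = a`; `of_mem_span_root` — `a ∈ (u)`;
* `exists_quotRootHom` / `exists_quotRootInv` / `nonempty_quotRootEquiv` — **`B ⧸ (u) ≃+* S ⧸ (a)`** (`p ≥ 1`; both
  are `S[U]/(U, a)`), stated as `Nonempty` to keep the file definition-free;
* `charP_adjoinRoot` — `B` has characteristic `p` when `S` has (free of rank `p ≥ 1` over a nontrivial `S`);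
* `nonempty_shiftEquiv` — **`S[T]/(T^p − f) ≃+* S[T]/(T^p − (f − g^p))`** in characteristic `p` (`T ↦ T + g`);
* `root_not_mem_sq` — for a LOCAL `S` and `a ∈ 𝔪`, `p ≥ 2`: **`u ∉ 𝔑²`** where `𝔑 = 𝔪B + (u)` is the maximal ideal of
  the local ring `B` (tree `AdjoinRoot.isLocalRing_and_maximalIdeal_eq`); probe `B → κ[ε]`, `U ↦ ε`, `S → κ`
  (`ε^p = 0 = ā`): `𝔑 ↦ (ε)`, `(ε)² = 0`, `ε ≠ 0`.
[cite: Matsumura1987, Thm. 14.2] [folklore]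
-/

noncomputable section

-- `Summit.<S>.<S>.…` duplicates the summit name by design (single-problem summit).
set_option linter.dupNamespace false

open Polynomial IsLocalRing

namespace Summit.ResolutionOfSingularities.ResolutionOfSingularities.Theorems.SwitchingDichotomy.RadicandSingular

open Literature.AlgebraicGeometry.Resolution

universe u

/-! ## §1 Generic glue over a commutative ring: `u^p = a`, the quotient `B/(u) ≅ S/(a)`, the shift `T ↦ T + g` -/

section Generic

variable {S : Type u} [CommRing S] {p : ℕ}

/-- `u ^ p = a` in `S[U]/(U^p − a)`. [folklore] -/
theorem root_pow_eq_of (a : S) :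
    AdjoinRoot.root (X ^ p - C a : S[X]) ^ p = AdjoinRoot.of (X ^ p - C a : S[X]) a := by
  have := AdjoinRoot.eval₂_root (X ^ p - C a : S[X])
  rwa [eval₂_sub, eval₂_X_pow, eval₂_C, sub_eq_zero] at this

/-- **The map `S[U]/(U^p − a) ⧸ (u) → S ⧸ (a)`** (`U ↦ 0`; `p ≥ 1`), with its values on `S` and on `u`. [folklore] -/
theorem exists_quotRootHom (a : S) (hp : 0 < p) :
    ∃ ψ : (AdjoinRoot (X ^ p - C a : S[X]) ⧸ Ideal.span {AdjoinRoot.root (X ^ p - C a : S[X])}) →+*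
        S ⧸ Ideal.span ({a} : Set S),
      (∀ s : S, ψ (Ideal.Quotient.mk _ (AdjoinRoot.of _ s)) = Ideal.Quotient.mk _ s) ∧
        ψ (Ideal.Quotient.mk _ (AdjoinRoot.root _)) = 0 := by
  have h0 : (X ^ p - C a : S[X]).eval₂ (Ideal.Quotient.mk (Ideal.span ({a} : Set S))) 0 = 0 := by
    rw [eval₂_sub, eval₂_X_pow, eval₂_C, zero_pow hp.ne', zero_sub, neg_eq_zero,
      Ideal.Quotient.eq_zero_iff_mem]
    exact Ideal.subset_span rfl
  have hker : ∀ x ∈ Ideal.span {AdjoinRoot.root (X ^ p - C a : S[X])},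
      AdjoinRoot.lift (Ideal.Quotient.mk (Ideal.span ({a} : Set S))) 0 h0 x = 0 := by
    intro x hx
    obtain ⟨y, rfl⟩ := Ideal.mem_span_singleton'.mp hx
    rw [map_mul, AdjoinRoot.lift_root, mul_zero]
  refine ⟨Ideal.Quotient.lift _ (AdjoinRoot.lift (Ideal.Quotient.mk _) 0 h0) hker, fun s => ?_, ?_⟩
  · rw [Ideal.Quotient.lift_mk, AdjoinRoot.lift_of]
  · rw [Ideal.Quotient.lift_mk, AdjoinRoot.lift_root]

/-- `a ∈ (u)` in `S[U]/(U^p − a)` (`p ≥ 1`), as `a = u^p`. [folklore] -/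
theorem of_mem_span_root (a : S) (hp : 0 < p) :
    AdjoinRoot.of (X ^ p - C a : S[X]) a ∈ Ideal.span {AdjoinRoot.root (X ^ p - C a : S[X])} := by
  rw [Ideal.mem_span_singleton']
  exact ⟨AdjoinRoot.root (X ^ p - C a : S[X]) ^ (p - 1), by
    rw [← pow_succ, Nat.sub_add_cancel hp, root_pow_eq_of]⟩

/-- **The map `S ⧸ (a) → S[U]/(U^p − a) ⧸ (u)`** (`s ↦ s` kills `a = u^p`; `p ≥ 1`). [folklore] -/
theorem exists_quotRootInv (a : S) (hp : 0 < p) :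
    ∃ φ : S ⧸ Ideal.span ({a} : Set S) →+*
        (AdjoinRoot (X ^ p - C a : S[X]) ⧸ Ideal.span {AdjoinRoot.root (X ^ p - C a : S[X])}),
      ∀ s : S, φ (Ideal.Quotient.mk _ s) = Ideal.Quotient.mk _ (AdjoinRoot.of _ s) := by
  refine ⟨Ideal.Quotient.lift (Ideal.span ({a} : Set S))
    ((Ideal.Quotient.mk (Ideal.span {AdjoinRoot.root (X ^ p - C a : S[X])})).comp
      (AdjoinRoot.of (X ^ p - C a : S[X]))) ?_, fun s => ?_⟩
  · intro s hs
    obtain ⟨y, rfl⟩ := Ideal.mem_span_singleton'.mp hs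
    rw [RingHom.comp_apply, Ideal.Quotient.eq_zero_iff_mem, map_mul]
    exact Ideal.mul_mem_left _ _ (of_mem_span_root a hp)
  · rw [Ideal.Quotient.lift_mk, RingHom.comp_apply]

/-- **`S[U]/(U^p − a) ⧸ (u) ≃ S ⧸ (a)`** (`p ≥ 1`): both are `S[U]/(U, a)`. (Stated as `Nonempty` to keep this file
definition-free.) [folklore] -/
theorem nonempty_quotRootEquiv (a : S) (hp : 0 < p) :
    Nonempty ((AdjoinRoot (X ^ p - C a : S[X]) ⧸ Ideal.span {AdjoinRoot.root (X ^ p - C a : S[X])}) ≃+*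
      S ⧸ Ideal.span ({a} : Set S)) := by
  obtain ⟨ψ, hψof, hψroot⟩ := exists_quotRootHom a hp
  obtain ⟨φ, hφ⟩ := exists_quotRootInv a hp
  refine ⟨RingEquiv.ofRingHom ψ φ ?_ ?_⟩
  · apply Ideal.Quotient.ringHom_ext
    ext s
    rw [RingHom.comp_apply, RingHom.comp_apply, RingHom.comp_apply, RingHom.id_apply, hφ, hψof]
  · apply Ideal.Quotient.ringHom_ext
    apply AdjoinRoot.ringHom_ext
    · ext s
      rw [RingHom.comp_apply, RingHom.comp_apply, RingHom.comp_apply, RingHom.comp_apply, RingHom.comp_apply,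
        RingHom.id_apply, hψof, hφ]
    · rw [RingHom.comp_apply, RingHom.comp_apply, RingHom.comp_apply, RingHom.id_apply, hψroot, map_zero, eq_comm,
        Ideal.Quotient.eq_zero_iff_mem]
      exact Ideal.subset_span rfl

variable [Fact p.Prime] [CharP S p]

/-- Over a nontrivial `S` of characteristic `p`, `S[U]/(U^p − a)` has characteristic `p`: it is a free `S`-module of
rank `p ≥ 1`, so the structure map is injective. [folklore] -/
theorem charP_adjoinRoot [Nontrivial S] (a : S) : CharP (AdjoinRoot (X ^ p - C a : S[X])) p := by
  have hmon : (X ^ p - C a : S[X]).Monic := monic_X_pow_sub_C a (Fact.out : p.Prime).ne_zero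
  haveI : Module.Free S (AdjoinRoot (X ^ p - C a : S[X])) := hmon.free_adjoinRoot
  haveI : Nontrivial (AdjoinRoot (X ^ p - C a : S[X])) := by
    have hrank : Module.finrank S (AdjoinRoot (X ^ p - C a : S[X])) = p := by
      rw [(AdjoinRoot.powerBasis' hmon).finrank, AdjoinRoot.powerBasis'_dim, natDegree_X_pow_sub_C]
    exact Module.nontrivial_of_finrank_pos (R := S) (by rw [hrank]; exact (Fact.out : p.Prime).pos)
  exact charP_of_injective_algebraMap (FaithfulSMul.algebraMap_injective S _) p

/-- **`S[T]/(T^p − f) ≃ S[T]/(T^p − (f − g^p))`** in characteristic `p` (`T ↦ T + g`, inverse `T ↦ T − g`; stated as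
`Nonempty` to keep this file definition-free). [folklore] -/
theorem nonempty_shiftEquiv [Nontrivial S] (f g : S) :
    Nonempty (AdjoinRoot (X ^ p - C f : S[X]) ≃+* AdjoinRoot (X ^ p - C (f - g ^ p) : S[X])) := by
  -- `T ↦ T + g` is well defined: `(u + g)^p − f = u^p + g^p − f = 0`
  have h1 : (X ^ p - C f : S[X]).eval₂ (AdjoinRoot.of (X ^ p - C (f - g ^ p) : S[X]))
      (AdjoinRoot.root _ + AdjoinRoot.of _ g) = 0 := by
    haveI := charP_adjoinRoot (p := p) (f - g ^ p)
    rw [eval₂_sub, eval₂_X_pow, eval₂_C, add_pow_char, root_pow_eq_of, ← map_pow, ← map_add, ← map_sub]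
    simp
  -- `T ↦ T − g` is well defined: `(t − g)^p − (f − g^p) = t^p − g^p − f + g^p = 0`
  have h2 : (X ^ p - C (f - g ^ p) : S[X]).eval₂ (AdjoinRoot.of (X ^ p - C f : S[X]))
      (AdjoinRoot.root _ - AdjoinRoot.of _ g) = 0 := by
    haveI := charP_adjoinRoot (p := p) f
    rw [eval₂_sub, eval₂_X_pow, eval₂_C, sub_pow_char, root_pow_eq_of, ← map_pow, ← map_sub, ← map_sub]
    simp
  refine ⟨RingEquiv.ofRingHom (AdjoinRoot.lift _ _ h1) (AdjoinRoot.lift _ _ h2) ?_ ?_⟩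
  · apply AdjoinRoot.ringHom_ext
    · ext s; simp
    · simp
  · apply AdjoinRoot.ringHom_ext
    · ext s; simp
    · simp

end Generic

/-! ## §2 Over a LOCAL ring: `u ∉ 𝔑²` for a radicand `a ∈ 𝔪` (dual-number probe) -/

section Local

variable {S : Type u} [CommRing S] [IsLocalRing S] {p : ℕ}

/-- **`u ∉ 𝔑²` in `B = S[U]/(U^p − a)` for `a ∈ 𝔪`, `p ≥ 2`** (`B` local with `𝔑 = 𝔪B + (u)`, tree
`AdjoinRoot.isLocalRing_and_maximalIdeal_eq`): the ring map `B → κ[ε]`, `U ↦ ε`, `S → κ` (well defined as `ε^p = 0 = ā`)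
sends `𝔑` into `(ε)`, whose square is `0`, but `ε ≠ 0`. [folklore] -/
theorem root_not_mem_sq (hp : 2 ≤ p) {a : S} (ha : a ∈ maximalIdeal S)
    [IsLocalRing (AdjoinRoot (X ^ p - C a : S[X]))] :
    AdjoinRoot.root (X ^ p - C a : S[X]) ∉ maximalIdeal (AdjoinRoot (X ^ p - C a : S[X])) ^ 2 := by
  have hp0 : 0 < p := lt_of_lt_of_le two_pos hp
  obtain ⟨_, hmax⟩ := AdjoinRoot.isLocalRing_and_maximalIdeal_eq (y := a) hp0 ha
  -- the probe `φ : B → κ[ε]`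
  have heps : (DualNumber.eps : DualNumber (ResidueField S)) ^ p = 0 := by
    obtain ⟨k, hk⟩ := Nat.exists_eq_add_of_le hp
    rw [hk, pow_add, pow_two, DualNumber.eps_mul_eps, zero_mul]
  let φ : AdjoinRoot (X ^ p - C a : S[X]) →+* DualNumber (ResidueField S) :=
    AdjoinRoot.lift ((algebraMap (ResidueField S) (DualNumber (ResidueField S))).comp (residue S))
      DualNumber.eps (by
      rw [eval₂_sub, eval₂_X_pow, eval₂_C, heps, RingHom.comp_apply, (residue_eq_zero_iff _).mpr ha, map_zero,
        sub_zero])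
  have hφof : ∀ s : S, φ (AdjoinRoot.of _ s) =
      algebraMap (ResidueField S) (DualNumber (ResidueField S)) (residue S s) := fun s => by
    simp [φ]
  have hφroot : φ (AdjoinRoot.root _) = DualNumber.eps := by simp [φ]
  -- `φ(𝔑) ⊆ (ε)`
  have hN : (maximalIdeal (AdjoinRoot (X ^ p - C a : S[X]))).map φ ≤
      Ideal.span {(DualNumber.eps : DualNumber (ResidueField S))} := by
    rw [hmax, Ideal.map_sup, Ideal.map_map, Ideal.map_span, Set.image_singleton, hφroot]
    refine sup_le ?_ le_rfl
    rw [Ideal.map_le_iff_le_comap]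
    intro s hs
    rw [Ideal.mem_comap, RingHom.comp_apply]
    change φ (AdjoinRoot.of _ s) ∈ _
    rw [hφof, (residue_eq_zero_iff _).mpr hs, map_zero]
    exact Ideal.zero_mem _
  -- `(ε)² = 0`
  have hsq : (Ideal.span {(DualNumber.eps : DualNumber (ResidueField S))}) ^ 2 = ⊥ := by
    rw [Ideal.span_singleton_pow, pow_two, DualNumber.eps_mul_eps, Ideal.span_singleton_eq_bot]
  intro hmem
  have h1 : φ (AdjoinRoot.root _) ∈ ((maximalIdeal (AdjoinRoot (X ^ p - C a : S[X]))).map φ) ^ 2 := by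
    rw [← Ideal.map_pow]
    exact Ideal.mem_map_of_mem φ hmem
  have h2 : φ (AdjoinRoot.root _) ∈ (Ideal.span {(DualNumber.eps : DualNumber (ResidueField S))}) ^ 2 :=
    Ideal.pow_right_mono hN 2 h1
  rw [hsq, Ideal.mem_bot, hφroot] at h2
  have := congrArg TrivSqZeroExt.snd h2
  rw [DualNumber.snd_eps, TrivSqZeroExt.snd_zero] at this
  exact one_ne_zero this

end Local

end Summit.ResolutionOfSingularities.ResolutionOfSingularities.Theorems.SwitchingDichotomy.RadicandSingular

end
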